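import Literature.Probability.LatticeModels.CriticalGibbsUniqueness
import Literature.Probability.LatticeModels.PlusMinusStateGibbs
import Literature.Probability.LatticeModels.GibbsStatesProofs
import HarnessLib

/-!
# Identifying an Ising Gibbs measure with the plus or the minus state

Topic `Probability/LatticeModels`; theorems only. Tools for the conclusions "`μ = μ⁻`" /
"`μ = μ⁺`" in the percolation analysis of Georgii–Higuchi 2000 (§2, p. 3: "the sandwich relation
`μ⁻ ≼ μ ≼ μ⁺` for any other `μ ∈ 𝒢`, and the resulting extremality of `μ⁺` and `μ⁻`"; proof of
Lemma 2.1, p. 5: "`μ ≼ μ⁻` on `𝓕_Δ`. Since `Δ` was arbitrary and `μ⁻` is minimal we find that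
`μ = μ⁻`"):

* `measure_eq_of_forall_plusCylinder_eq` — two probability measures on `{±1}^V` agreeing on the
  increasing cylinder events `{σ_B ≡ +1}` are equal (π-system, `CriticalGibbsUniqueness`).
* `integral_eq_minusExpect_of_forall_spinCorr`, `integral_eq_plusExpect_of_forall_spinCorr` —
  a probability measure with the correlations of `⟨·⟩⁻_{β,h}` (resp. `⟨·⟩⁺_{β,h}`) integrates
  every local observable to `minusExpect` (resp. `plusExpect`) (Friedli–Velenik 2017, Thm. 3.17
  with Lemma 3.19: local functions are finite sums of spin products).
* **`spinCorr_eq_minusCorr_of_forall_integral_le_minusExpect`** — *minimality of `μ⁻`*: if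
  `μ ∈ 𝒢(β, h)` satisfies `μ(f) ≤ ⟨f⟩⁻_{β,h}` for all nondecreasing local `f`, then `μ` has the
  correlations of the minus state (sandwich `⟨f⟩⁻ ≤ μ(f)`, `fkg_sandwich_holds`, and the
  π-system); and the mirror statement **`spinCorr_eq_plusCorr_of_forall_plusExpect_le_integral`**.

## References

* H.-O. Georgii, Y. Higuchi, J. Math. Phys. 41 (2000) 1153–1169, §2 p. 3, Lemma 2.1 p. 5
  [GeorgiiHiguchi2000].
* S. Friedli, Y. Velenik, *Statistical Mechanics of Lattice Systems*, CUP 2017, Thm. 3.17,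
  Lemma 3.19, Lemma 6.30 / eq. (6.70) [FriedliVelenik2017].
-/

noncomputable section

open MeasureTheory Filter Topology Finset

namespace Literature.Probability.LatticeModels

/-! ### Probability measures on `{±1}^V` are determined by the increasing cylinders -/

section Cylinders

variable {V : Type*} [DecidableEq V]

/-- **Two probability measures agreeing on the increasing cylinder events `{σ_B ≡ +1}`, `B`
finite, are equal** (these events form a π-system generating the product σ-algebra;
`isPiSystem_range_forall_eq_one`, `generateFrom_range_forall_eq_one`). [folklore] -/
theorem measure_eq_of_forall_plusCylinder_eq (μ ν : Measure (SpinConfig V))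
    [IsProbabilityMeasure μ] [IsProbabilityMeasure ν]
    (h : ∀ B : Finset V, μ {σ : SpinConfig V | ∀ i ∈ B, σ i = 1} = ν {σ | ∀ i ∈ B, σ i = 1}) :
    μ = ν := by
  refine ext_of_generate_finite _ generateFrom_range_forall_eq_one isPiSystem_range_forall_eq_one
    ?_ (by rw [measure_univ, measure_univ])
  rintro _ ⟨B, rfl⟩
  exact h B

/-- **Two probability measures with equal expectations of all nondecreasing local bounded
measurable observables are equal** (take the indicators of the increasing cylinders
`{σ_B ≡ +1}`, `monotone_indicator_forall_eq_one`). [folklore] -/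
theorem measure_eq_of_forall_integral_monotone_local_eq (μ ν : Measure (SpinConfig V))
    [IsProbabilityMeasure μ] [IsProbabilityMeasure ν]
    (h : ∀ (f : SpinConfig V → ℝ), Monotone f → Measurable f →
      (∃ Λ : Finset V, DependsOn f (↑Λ : Set V)) → (∃ C, ∀ σ, |f σ| ≤ C) →
        ∫ σ, f σ ∂μ = ∫ σ, f σ ∂ν) : μ = ν := by
  refine measure_eq_of_forall_plusCylinder_eq μ ν fun B => ?_
  have hm : MeasurableSet {σ : SpinConfig V | ∀ i ∈ B, σ i = 1} := measurableSet_forall_eq_one B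
  have hdep : DependsOn (({σ : SpinConfig V | ∀ i ∈ B, σ i = 1}).indicator (1 : SpinConfig V → ℝ))
      (↑B : Set V) := by
    intro σ τ hστ
    have hiff : σ ∈ {σ : SpinConfig V | ∀ i ∈ B, σ i = 1} ↔ τ ∈ {σ : SpinConfig V | ∀ i ∈ B, σ i = 1} := by
      simp only [Set.mem_setOf_eq]
      exact ⟨fun hσ i hi => (hστ i (Finset.mem_coe.2 hi)) ▸ hσ i hi,
        fun hτ i hi => (hστ i (Finset.mem_coe.2 hi)).symm ▸ hτ i hi⟩
    by_cases hσ : σ ∈ {σ : SpinConfig V | ∀ i ∈ B, σ i = 1}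
    · rw [Set.indicator_of_mem hσ, Set.indicator_of_mem (hiff.1 hσ)]
      rfl
    · rw [Set.indicator_of_notMem hσ, Set.indicator_of_notMem (fun h' => hσ (hiff.2 h'))]
  have hbd : ∃ C : ℝ, ∀ σ, |({σ : SpinConfig V | ∀ i ∈ B, σ i = 1}).indicator
      (1 : SpinConfig V → ℝ) σ| ≤ C := ⟨1, fun σ => by
    by_cases hσ : σ ∈ {σ : SpinConfig V | ∀ i ∈ B, σ i = 1}
    · simp [Set.indicator_of_mem hσ]
    · simp [Set.indicator_of_notMem hσ]⟩
  have key := h _ (monotone_indicator_forall_eq_one B) (measurable_one.indicator hm) ⟨B, hdep⟩ hbd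
  rw [integral_indicator_one hm, integral_indicator_one hm] at key
  have key' : μ.real {σ : SpinConfig V | ∀ i ∈ B, σ i = 1} = ν.real {σ | ∀ i ∈ B, σ i = 1} := key
  rw [measureReal_def, measureReal_def, ENNReal.toReal_eq_toReal_iff' (measure_ne_top _ _)
    (measure_ne_top _ _)] at key'
  exact key'

end Cylinders

/-! ### Measures with the `±` correlations integrate local observables to `⟨·⟩^±` -/

section States

variable {d : ℕ} {β h : ℝ}

/-- A local observable is a finite linear combination of spin products, so a probability measure
whose correlations are the box limits `c B = lim ⟨σ_B⟩^{bc}_{B(L)}` integrates it to the limit of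
its box expectations (Friedli–Velenik 2017, proof of Thm. 3.17 via Lemma 3.19). [cite: FriedliVelenik2017, Thm. 3.17 (proof) and Lemma 3.19] -/
theorem integral_eq_limUnder_isingExpect_box_of_forall_spinCorr (bc : BoundaryCondition (Site d))
    {c : Finset (Site d) → ℝ}
    (hcorr : ∀ B : Finset (Site d),
      Tendsto (fun L : ℕ => isingCorr (zdGraph d) (box d L) β h bc B) atTop (𝓝 (c B)))
    (μ : Measure (SpinConfig (Site d))) [IsProbabilityMeasure μ]
    (hμ : ∀ B : Finset (Site d), spinCorr μ B = c B)
    {D : Finset (Site d)} {F : SpinConfig (Site d) → ℝ} (hF : DependsOn F (↑D : Set (Site d))) :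
    ∫ σ, F σ ∂μ = limUnder atTop (fun L : ℕ => isingExpect (zdGraph d) (box d L) β h bc F) := by
  classical
  obtain ⟨coef, hc⟩ := exists_sum_spinProduct_of_dependsOn D hF
  have hFeq : F = fun σ => ∑ B : Finset ↥D, coef B *
      spinProduct (B.map (Function.Embedding.subtype (· ∈ D))) σ := funext hc
  -- the box expectations converge to `∑ coef_B c_B`
  have hlin : ∀ L : ℕ, isingExpect (zdGraph d) (box d L) β h bc F =
      ∑ B : Finset ↥D, coef B * isingCorr (zdGraph d) (box d L) β h bc
        (B.map (Function.Embedding.subtype (· ∈ D))) := by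
    intro L
    rw [hFeq, isingExpect_finset_sum' _ _ _ _ β _ _ fun B =>
      (measurable_spinProduct _).const_mul (coef B)]
    refine Finset.sum_congr rfl fun B _ => ?_
    rw [isingExpect_const_mul' _ _ _ _ β (coef B) (measurable_spinProduct _)]
    rfl
  have hlim : Tendsto (fun L : ℕ => isingExpect (zdGraph d) (box d L) β h bc F) atTop
      (𝓝 (∑ B : Finset ↥D, coef B * c (B.map (Function.Embedding.subtype (· ∈ D))))) := by
    simp_rw [hlin]
    exact tendsto_finsetSum _ fun B _ => (hcorr _).const_mul _
  rw [hlim.limUnder_eq]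
  -- and `∫ F dμ = ∑ coef_B spinCorr μ B = ∑ coef_B c_B`
  rw [hFeq, integral_finsetSum _ fun B _ => (integrable_spinProduct μ _).const_mul (coef B)]
  refine Finset.sum_congr rfl fun B _ => ?_
  rw [integral_const_mul, ← hμ]
  rfl

/-- **A probability measure with the minus correlations integrates local observables to the
minus state**: if `spinCorr μ B = ⟨σ_B⟩⁻_{β,h}` for all `B` (`β ≥ 0`), then
`∫ F dμ = minusExpect d β h F` for every local `F` (Friedli–Velenik 2017, Thm. 3.17 with
Lemma 3.19; box correlations converge by `tendsto_isingCorr_minus_box`). [cite: FriedliVelenik2017, Thm. 3.17 (proof) and Lemma 3.19] -/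
theorem integral_eq_minusExpect_of_forall_spinCorr (hβ : 0 ≤ β)
    (μ : Measure (SpinConfig (Site d))) [IsProbabilityMeasure μ]
    (hμ : ∀ B : Finset (Site d), spinCorr μ B = minusCorr d β h B)
    {D : Finset (Site d)} {F : SpinConfig (Site d) → ℝ} (hF : DependsOn F (↑D : Set (Site d))) :
    ∫ σ, F σ ∂μ = minusExpect d β h F :=
  integral_eq_limUnder_isingExpect_box_of_forall_spinCorr .minus
    (tendsto_isingCorr_minus_box hβ h) μ hμ hF

/-- **A probability measure with the plus correlations integrates local observables to the plus
state**: if `spinCorr μ B = ⟨σ_B⟩⁺_{β,h}` for all `B` (`β ≥ 0`), then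
`∫ F dμ = plusExpect d β h F` for every local `F` (Friedli–Velenik 2017, Thm. 3.17 with
Lemma 3.19; `tendsto_isingCorr_plus_box`). [cite: FriedliVelenik2017, Thm. 3.17 (proof) and Lemma 3.19] -/
theorem integral_eq_plusExpect_of_forall_spinCorr (hβ : 0 ≤ β)
    (μ : Measure (SpinConfig (Site d))) [IsProbabilityMeasure μ]
    (hμ : ∀ B : Finset (Site d), spinCorr μ B = plusCorr d β h B)
    {D : Finset (Site d)} {F : SpinConfig (Site d) → ℝ} (hF : DependsOn F (↑D : Set (Site d))) :
    ∫ σ, F σ ∂μ = plusExpect d β h F :=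
  integral_eq_limUnder_isingExpect_box_of_forall_spinCorr .plus
    (tendsto_isingCorr_plus_box hβ h) μ hμ hF

/-! ### Minimality of `μ⁻` and maximality of `μ⁺` in `𝒢(β, h)` -/

/-- **Minimality of the minus state** (Georgii–Higuchi 2000, proof of Lemma 2.1, p. 5: "since
`μ ≼ μ⁻` and `μ⁻` is minimal we find that `μ = μ⁻`"): for `β ≥ 0`, if `μ ∈ 𝒢(β, h)` satisfies
`∫ f dμ ≤ ⟨f⟩⁻_{β,h}` for every nondecreasing, local, bounded measurable `f`, then `μ` has the
correlations of the minus state (hence equals any Gibbs measure with those correlations). The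
reverse inequality is the FKG sandwich `fkg_sandwich_holds`; equality of the two probability
measures `μ` and `μ⁻` (`exists_minusMeasure_holds`) on increasing cylinders gives `μ = μ⁻`. [cite: GeorgiiHiguchi2000, Lemma 2.1 (proof, p. 5)] -/
theorem spinCorr_eq_minusCorr_of_forall_integral_le_minusExpect (hβ : 0 ≤ β)
    {μ : Measure (SpinConfig (Site d))} (hμ : μ ∈ isingGibbsMeasures d β h)
    (hle : ∀ (f : SpinConfig (Site d) → ℝ), Monotone f → Measurable f →
      (∃ Λ : Finset (Site d), DependsOn f (↑Λ : Set (Site d))) → (∃ C, ∀ σ, |f σ| ≤ C) →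
        ∫ σ, f σ ∂μ ≤ minusExpect d β h f) :
    ∀ A : Finset (Site d), spinCorr μ A = minusCorr d β h A := by
  obtain ⟨μm, hμmG, -, hμm⟩ := exists_minusMeasure_holds (d := d) (β := β) (h := h) hβ
  have hμG : IsGibbsMeasure (isingSpecification (zdGraph d) β h) μ := hμ
  have hμmG' : IsGibbsMeasure (isingSpecification (zdGraph d) β h) μm := hμmG
  haveI := hμG.isProbabilityMeasure
  haveI := hμmG'.isProbabilityMeasure
  suffices hEq : μ = μm by intro A; rw [hEq]; exact hμm A
  refine measure_eq_of_forall_integral_monotone_local_eq μ μm fun f hf hfm hloc hbd => ?_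
  obtain ⟨Λ, hΛ⟩ := hloc
  have hlow := (fkg_sandwich_holds (d := d) (β := β) (h := h) hβ μ hμ f hf ⟨Λ, hΛ⟩ hbd).1
  have hup := hle f hf hfm ⟨Λ, hΛ⟩ hbd
  rw [integral_eq_minusExpect_of_forall_spinCorr hβ μm hμm hΛ]
  exact le_antisymm hup hlow

/-- **Maximality of the plus state** (Georgii–Higuchi 2000, §2, p. 3, by the `±` symmetry of
Lemma 2.1): for `β ≥ 0`, if `μ ∈ 𝒢(β, h)` satisfies `⟨f⟩⁺_{β,h} ≤ ∫ f dμ` for every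
nondecreasing, local, bounded measurable `f`, then `μ` has the correlations of the plus state. [cite: GeorgiiHiguchi2000, Lemma 2.1 (proof, p. 5)] -/
theorem spinCorr_eq_plusCorr_of_forall_plusExpect_le_integral (hβ : 0 ≤ β)
    {μ : Measure (SpinConfig (Site d))} (hμ : μ ∈ isingGibbsMeasures d β h)
    (hge : ∀ (f : SpinConfig (Site d) → ℝ), Monotone f → Measurable f →
      (∃ Λ : Finset (Site d), DependsOn f (↑Λ : Set (Site d))) → (∃ C, ∀ σ, |f σ| ≤ C) →
        plusExpect d β h f ≤ ∫ σ, f σ ∂μ) :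
    ∀ A : Finset (Site d), spinCorr μ A = plusCorr d β h A := by
  obtain ⟨μp, hμpG, -, hμp⟩ := exists_plusMeasure_holds (d := d) (β := β) (h := h) hβ
  have hμG : IsGibbsMeasure (isingSpecification (zdGraph d) β h) μ := hμ
  have hμpG' : IsGibbsMeasure (isingSpecification (zdGraph d) β h) μp := hμpG
  haveI := hμG.isProbabilityMeasure
  haveI := hμpG'.isProbabilityMeasure
  suffices hEq : μ = μp by intro A; rw [hEq]; exact hμp A
  refine measure_eq_of_forall_integral_monotone_local_eq μ μp fun f hf hfm hloc hbd => ?_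
  obtain ⟨Λ, hΛ⟩ := hloc
  have hup := (fkg_sandwich_holds (d := d) (β := β) (h := h) hβ μ hμ f hf ⟨Λ, hΛ⟩ hbd).2
  have hlow := hge f hf hfm ⟨Λ, hΛ⟩ hbd
  rw [integral_eq_plusExpect_of_forall_spinCorr hβ μp hμp hΛ]
  exact le_antisymm hup hlow

end States

end Literature.Probability.LatticeModels
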